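import Mathlib.FieldTheory.Finite.Basic
import Mathlib.RingTheory.Henselian
import Literature.NumberTheory.Automorphic.AdicCompletionCompact
import Literature.RingTheory.DiscreteValuationRing.AdicCompletionHensel
import HarnessLib

/-!
# Local units are norms from `K_v(√a)` at the places `v ∤ 2`

Topic `NumberTheory/Automorphic` (next to `AdicCompletionCompact`); namespace `Literature.Automorphic`.
All declarations are fully proved.

For a number field `K`, a finite place `v` and `a, b ∈ K` with `v(a) = v(b) = v(2) = 0`
(normalised: valuation `= 1`), the equation `x² - a y² = b` is soluble in the completion `K_v`
(`exists_sq_sub_mul_sq_of_valuation_eq_one`). This is the computation of the tame Hilbert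
symbol `(a, b)_v = 1` for units `a, b` at a non-dyadic place: Vignéras, *Arithmétique des
algèbres de quaternions*, LNM 800, Ch. II §1, Lemme 1.10 and its proof ("si `e ∈ R* ∖ R*²`,
`R* ⊂ n(K(√e))`", via `R₁* = R₁*²` by the binomial series for `(1 + πa)^{1/2}`) together with the
"Table du symbole de Hilbert" following it (`(1,1) = (1,e) = (e,1) = (e,e) = 1`).

The proof given here is the standard one, in three steps:

* `FiniteField.exists_sq_sub_mul_sq` : over a finite field of odd characteristic,
  `x² - a y² = b` is soluble for `a ≠ 0` (pigeon-hole on the values of two quadratics, Mathlib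
  `FiniteField.exists_root_sum_quadratic`);
* `exists_sq_eq_of_sq_sub_mem_maximalIdeal` : Hensel's lemma for `X² - c` over a Henselian local
  ring in which `2` is a unit (Mathlib `HenselianLocalRing.is_henselian`), and
  `exists_sq_sub_mul_sq_of_isUnit` : hence units `a, b` of a Henselian local ring with finite
  residue field of odd characteristic satisfy `x² - a y² = b` for some `x, y`;
* `exists_sq_sub_mul_sq_of_valuation_eq_one` : the case of `𝒪_v ⊆ K_v`, which is Henselian
  (`IsDedekindDomain.HeightOneSpectrum.adicCompletionIntegers.henselianLocalRing`,
  `Literature/RingTheory/DiscreteValuationRing/AdicCompletionHensel.lean`) with finite residue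
  field (`finite_residueField_adicCompletion`, `AdicCompletionCompact.lean`).

It is the local input of the finiteness of the set of ramified places of a quaternion algebra
(`ramifiedPlaces_finite`, Vignéras III §1 Lemme 1.1), see
`QuaternionAlgebraAdelicRamificationProofs.lean`.

## References

* M.-F. Vignéras, *Arithmétique des algèbres de quaternions*, LNM 800, Springer (1980),
  doi:10.1007/BFb0091027, Ch. II §1, Lemme 1.10 and "Table du symbole de Hilbert" (pp. 36–37).
-/

noncomputable section

open NumberField IsDedekindDomain Valued Polynomial

namespace Literature.NumberTheory.Automorphic

/-! ### Finite fields of odd characteristic -/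

/-- Over a finite field `k` of odd characteristic, for `a ≠ 0` and any `b` the equation
`x² - a y² = b` has a solution (the quadratics `X²` and `-a Y² - b` take `(q+1)/2` values each,
so `x² = a y² + b` for some `x, y`; Mathlib `FiniteField.exists_root_sum_quadratic`). This is the
residue-field step of Vignéras II §1 Lemme 1.10 (`R* ⊂ n(K(√e))`). [folklore] -/
theorem FiniteField.exists_sq_sub_mul_sq {k : Type*} [Field k] [Fintype k] (hk : ringChar k ≠ 2)
    {a : k} (ha : a ≠ 0) (b : k) : ∃ x y : k, x ^ 2 - a * y ^ 2 = b := by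
  obtain ⟨x, y, h⟩ := FiniteField.exists_root_sum_quadratic (R := k)
    (f := C 1 * X ^ 2 + C 0 * X + C 0) (g := C (-a) * X ^ 2 + C 0 * X + C (-b))
    (degree_quadratic one_ne_zero) (degree_quadratic (neg_ne_zero.mpr ha))
    (FiniteField.odd_card_of_char_ne_two hk)
  exact ⟨x, y, by simp at h; linear_combination h⟩

/-! ### Henselian local rings with finite residue field of odd characteristic -/

/-- **Hensel's lemma for square roots**: in a Henselian local ring `R` in which `2` is a unit, if
`z₀` is a unit with `z₀² ≡ c (mod 𝔪)` then `c` is a square (apply Mathlib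
`HenselianLocalRing.is_henselian` to the monic polynomial `X² - c`, whose derivative `2 z₀` at
`z₀` is a unit). Vignéras II §1, proof of Lemme 1.10 (`R₁* = R₁*²`). [folklore] -/
theorem exists_sq_eq_of_sq_sub_mem_maximalIdeal {R : Type*} [CommRing R] [HenselianLocalRing R]
    (h2 : IsUnit (2 : R)) {c z₀ : R} (hz₀ : IsUnit z₀)
    (hc : z₀ ^ 2 - c ∈ IsLocalRing.maximalIdeal R) : ∃ z : R, z ^ 2 = c := by
  have hd : (derivative (X ^ 2 - C c)).eval z₀ = 2 * z₀ := by
    simp; norm_num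
  obtain ⟨z, hz, -⟩ := HenselianLocalRing.is_henselian (X ^ 2 - C c)
    (monic_X_pow_sub_C c two_ne_zero) z₀ (by simpa using hc) (by rw [hd]; exact h2.mul hz₀)
  exact ⟨z, by simpa [sub_eq_zero] using hz⟩

/-- **Units are norms from `R[√a]` (tame case)**: let `R` be a Henselian local ring with finite
residue field in which `2` is a unit, and let `a, b ∈ Rˣ`. Then `x² - a y² = b` for some
`x, y ∈ R`: solve `x̄² - ā ȳ² = b̄` in the residue field (`FiniteField.exists_sq_sub_mul_sq`) and
lift by Hensel — if `ȳ ≠ 0` lift `ȳ` to a square root of `a⁻¹ (x² - b)`, otherwise `x̄² = b̄ ≠ 0`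
and lift `x̄` to a square root of `b`. For `R = 𝒪_v` this is Vignéras II §1 Lemme 1.10 (with
the Hilbert-symbol table: `(a, b)_v = 1` for units at a non-dyadic place).
[cite: VignerasLNM800, Ch. II §1 Lemme 1.10 and Table du symbole de Hilbert (pp. 36–37)] -/
theorem exists_sq_sub_mul_sq_of_isUnit {R : Type*} [CommRing R] [HenselianLocalRing R]
    [Finite (IsLocalRing.ResidueField R)] (h2 : IsUnit (2 : R)) {a b : R} (ha : IsUnit a)
    (hb : IsUnit b) : ∃ x y : R, x ^ 2 - a * y ^ 2 = b := by
  classical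
  set k := IsLocalRing.ResidueField R
  letI : Fintype k := Fintype.ofFinite k
  have hres : ∀ {z : R}, IsUnit z → IsLocalRing.residue R z ≠ 0 := fun hz h ↦ by
    rw [IsLocalRing.residue_eq_zero_iff, IsLocalRing.mem_maximalIdeal] at h
    exact h hz
  have hunit : ∀ {z : R}, IsLocalRing.residue R z ≠ 0 → IsUnit z := fun hz ↦ by
    rw [Ne, IsLocalRing.residue_eq_zero_iff, IsLocalRing.mem_maximalIdeal] at hz
    exact not_not.mp hz
  -- the residue field has odd characteristic
  have hk : ringChar k ≠ 2 := by
    intro h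
    apply hres h2
    have := ringChar.Nat.cast_ringChar (R := k)
    rw [h] at this
    rw [map_ofNat]
    exact_mod_cast this
  -- solve modulo `𝔪` and lift the solution
  obtain ⟨xb, yb, hxy⟩ := FiniteField.exists_sq_sub_mul_sq hk (hres ha) (IsLocalRing.residue R b)
  obtain ⟨x₀, rfl⟩ := IsLocalRing.residue_surjective xb
  obtain ⟨y₀, rfl⟩ := IsLocalRing.residue_surjective yb
  by_cases hy : IsLocalRing.residue R y₀ = 0
  · -- `x₀² ≡ b`: lift `x₀` to a square root of `b` (Hensel), take `y = 0`
    rw [hy] at hxy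
    have hx : IsUnit x₀ := hunit (by
      rintro h
      rw [h] at hxy
      exact hres hb (by rw [← hxy]; ring))
    obtain ⟨x, hx⟩ := exists_sq_eq_of_sq_sub_mem_maximalIdeal h2 hx (c := b) (by
      rw [← IsLocalRing.residue_eq_zero_iff, map_sub, map_pow]
      simpa [sub_eq_zero] using hxy)
    exact ⟨x, 0, by simp [hx]⟩
  · -- `y₀` is a unit: lift `y₀` to a square root of `a⁻¹ (x₀² - b)` (Hensel)
    have hy' : IsUnit y₀ := hunit hy
    obtain ⟨y, hy⟩ := exists_sq_eq_of_sq_sub_mem_maximalIdeal h2 hy'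
      (c := ↑(ha.unit⁻¹) * (x₀ ^ 2 - b)) (by
      rw [← IsLocalRing.residue_eq_zero_iff, map_sub, map_pow, map_mul, map_units_inv, map_sub,
        map_pow, IsUnit.unit_spec]
      have ha0 : IsLocalRing.residue R a ≠ 0 := hres ha
      field_simp
      linear_combination -hxy)
    refine ⟨x₀, y, ?_⟩
    rw [hy, ← mul_assoc, IsUnit.mul_val_inv, one_mul]
    ring

/-! ### The completions `K_v` of a number field at the places `v ∤ 2` -/

variable {K : Type*} [Field K] [NumberField K] (v : HeightOneSpectrum (𝓞 K))

/-- **`x² - a y² = b` is soluble in `K_v` when `v(a) = v(b) = v(2) = 0`** (valuations normalised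
to `1`), i.e. the Hilbert symbol `(a, b)_v` is `1` for `v`-units `a, b` at a place `v ∤ 2` of the
number field `K` (Vignéras II §1, Lemme 1.10 with the "Table du symbole de Hilbert": for the local
field `K_v` of odd residue characteristic and a unit `e` which is not a square,
`R* ⊂ n(K_v(√e))`, and `(a, b)_v = 1` for `a, b ∈ {1, e}` modulo squares). Proof: `a, b, 2` are
units of the valuation ring `𝒪_v`, which is Henselian
(`IsDedekindDomain.HeightOneSpectrum.adicCompletionIntegers.henselianLocalRing`) with finite
residue field (`finite_residueField_adicCompletion`), so `exists_sq_sub_mul_sq_of_isUnit`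
applies. [cite: VignerasLNM800, Ch. II §1 Lemme 1.10 and Table du symbole de Hilbert (pp. 36–37)] -/
theorem exists_sq_sub_mul_sq_of_valuation_eq_one {a b : K} (ha : v.valuation K a = 1)
    (hb : v.valuation K b = 1) (h2 : v.valuation K (2 : K) = 1) :
    ∃ x y : v.adicCompletion K,
      x ^ 2 - algebraMap K (v.adicCompletion K) a * y ^ 2 =
        algebraMap K (v.adicCompletion K) b := by
  haveI : HenselianLocalRing 𝒪[v.adicCompletion K] :=
    inferInstanceAs (HenselianLocalRing (v.adicCompletionIntegers K))
  haveI : Finite 𝓀[v.adicCompletion K] := finite_residueField_adicCompletion K v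
  have hval : ∀ c : K, Valued.v (algebraMap K (v.adicCompletion K) c) = v.valuation K c :=
    fun c ↦ HeightOneSpectrum.valuedAdicCompletion_eq_valuation' v c
  have hint : (Valued.v (R := v.adicCompletion K)).Integers 𝒪[v.adicCompletion K] :=
    Valuation.integer.integers _
  -- global elements of valuation `1` are local units
  have hmem : ∀ {c : K}, v.valuation K c = 1 →
      algebraMap K (v.adicCompletion K) c ∈ 𝒪[v.adicCompletion K] := fun {c} hc ↦ by
    rw [Valuation.mem_integer_iff, hval, hc]
  have hunit : ∀ {c : K} (hc : v.valuation K c = 1),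
      IsUnit (⟨algebraMap K (v.adicCompletion K) c, hmem hc⟩ : 𝒪[v.adicCompletion K]) :=
    fun {c} hc ↦ hint.isUnit_iff_valuation_eq_one.mpr (by
      change Valued.v (algebraMap K (v.adicCompletion K) c) = 1
      rw [hval, hc])
  have h2' : IsUnit (2 : 𝒪[v.adicCompletion K]) := by
    convert hunit h2 using 1
    refine Subtype.ext ?_
    change ((2 : 𝒪[v.adicCompletion K]) : v.adicCompletion K) = algebraMap K _ 2
    rw [map_ofNat]
    norm_cast
  obtain ⟨x, y, hxy⟩ := exists_sq_sub_mul_sq_of_isUnit h2' (hunit ha) (hunit hb)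
  exact ⟨x, y, by simpa using congr_arg Subtype.val hxy⟩

end Literature.NumberTheory.Automorphic
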